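import Mathlib.Analysis.SpecialFunctions.Trigonometric.Sinc
import Mathlib.Analysis.SpecialFunctions.Integrals.Basic
import Mathlib.MeasureTheory.Integral.Pi
import Mathlib.MeasureTheory.Measure.Haar.InnerProductSpace
import Mathlib.MeasureTheory.Integral.IntervalIntegral.IntegrationByParts
import Literature.MathematicalPhysics.QuantumManyBody.BoseEinsteinCondensation
import HarnessLib

/-!
# Route `BECSubharmonicContinuation`, support `CoreDeficitBounds` (stmt-AtomisticToContinuum-9004) —
# helper: the Fejér (tent) kernel identity on `ℝ³`

For `k ∈ ℝ³` and `R > 0`,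

`∫_{ℝ³} ∏ⱼ (1 - |yⱼ|/R)₊ · cos(∑ⱼ kⱼ yⱼ) dy = R³ ∏ⱼ sinc²(kⱼ R / 2)`

(`integral_tent_mul_cos`): the translate-averaged cube window of side `R` has Fourier multiplier
`∏ⱼ sinc²(kⱼR/2)` (Fejér). Proof: the integrand is the real part of the product
`∏ⱼ (1 - |yⱼ|/R)₊ e^{i kⱼ yⱼ}`, Fubini over the three coordinates
(`MeasureTheory.integral_fintype_prod_volume_eq_prod` after the volume-preserving identification
`ℝ³ ≃ (Fin 3 → ℝ)`), and the one-dimensional Fejér integral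
`∫ (1 - |t|/R)₊ cos(κt) dt = 2∫₀ᴿ (1 - t/R) cos(κt) dt = R sinc²(κR/2)`,
`∫ (1 - |t|/R)₊ sin(κt) dt = 0`. Also: the tent is integrable, non-negative, bounded by `1`,
with `∫ tent = R³`.
-/

noncomputable section

open MeasureTheory Set Real intervalIntegral
open scoped BigOperators

namespace Summit.AtomisticToContinuum.BoseEinsteinCondensation.Theorems.CoreDeficitBounds

open Literature.MathematicalPhysics.QuantumManyBody.BoseGas (Space)

/-! ### The one-dimensional tent -/

/-- The one-dimensional tent `(1 - |t|/R)₊` is continuous. -/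
theorem continuous_tent₁ (R : ℝ) : Continuous fun t : ℝ => max (1 - |t| / R) 0 := by
  fun_prop

/-- The tent is non-negative. -/
theorem tent₁_nonneg (R t : ℝ) : 0 ≤ max (1 - |t| / R) 0 := le_max_right _ _

/-- The tent is at most `1` (`R > 0`). -/
theorem tent₁_le_one {R : ℝ} (hR : 0 < R) (t : ℝ) : max (1 - |t| / R) 0 ≤ 1 :=
  max_le (by linarith [div_nonneg (abs_nonneg t) hR.le]) zero_le_one

/-- The tent vanishes off `(-R, R]`. -/
theorem tent₁_eq_zero {R : ℝ} (hR : 0 < R) {t : ℝ} (ht : t ∉ Ioc (-R) R) :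
    max (1 - |t| / R) 0 = 0 := by
  apply max_eq_right
  rw [sub_nonpos, le_div_iff₀ hR, one_mul]
  rw [mem_Ioc, not_and_or, not_lt, not_le] at ht
  rcases ht with h | h
  · rw [abs_of_nonpos (by linarith)]; linarith
  · rw [abs_of_pos (by linarith)]; linarith

/-- A continuous function times the tent has support in `(-R, R]`. -/
theorem support_tent₁_mul_subset {R : ℝ} (hR : 0 < R) (g : ℝ → ℝ) :
    Function.support (fun t => max (1 - |t| / R) 0 * g t) ⊆ Ioc (-R) R := by
  intro t ht
  simp only [Function.mem_support, ne_eq] at ht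
  by_contra h
  exact ht (by rw [tent₁_eq_zero hR h, zero_mul])

/-- The tent times a continuous function is integrable on `ℝ`. -/
theorem integrable_tent₁_mul {R : ℝ} (hR : 0 < R) {g : ℝ → ℝ} (hg : Continuous g) :
    Integrable fun t => max (1 - |t| / R) 0 * g t := by
  refine Continuous.integrable_of_hasCompactSupport ((continuous_tent₁ R).mul hg) ?_
  exact HasCompactSupport.of_support_subset_isCompact (isCompact_Icc (a := -R) (b := R))
    ((support_tent₁_mul_subset hR g).trans Ioc_subset_Icc_self)

/-- The antiderivative of `(1 - t/R) cos(κt)` (`κ ≠ 0`). -/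
theorem hasDerivAt_fejerPrim {κ R : ℝ} (hκ : κ ≠ 0) (hR : R ≠ 0) (t : ℝ) :
    HasDerivAt (fun t => (1 - t / R) * Real.sin (κ * t) / κ - Real.cos (κ * t) / (κ ^ 2 * R))
      ((1 - t / R) * Real.cos (κ * t)) t := by
  have h1 : HasDerivAt (fun t : ℝ => 1 - t / R) (-(1 / R)) t := by
    simpa using ((hasDerivAt_id t).div_const R).const_sub 1
  have h2 : HasDerivAt (fun t : ℝ => Real.sin (κ * t)) (Real.cos (κ * t) * κ) t := by
    simpa using ((hasDerivAt_id t).const_mul κ).sin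
  have h3 : HasDerivAt (fun t : ℝ => Real.cos (κ * t)) (-Real.sin (κ * t) * κ) t := by
    simpa using ((hasDerivAt_id t).const_mul κ).cos
  have h := ((h1.mul h2).div_const κ).sub (h3.div_const (κ ^ 2 * R))
  refine h.congr_deriv ?_
  field_simp
  ring

/-- **The half Fejér integral**: `∫₀ᴿ (1 - t/R) cos(κt) dt = (R/2) sinc²(κR/2)`. -/
theorem integral_fejer_half (κ : ℝ) {R : ℝ} (hR : 0 < R) :
    ∫ t in (0 : ℝ)..R, (1 - t / R) * Real.cos (κ * t) = R / 2 * Real.sinc (κ * R / 2) ^ 2 := by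
  rcases eq_or_ne κ 0 with rfl | hκ
  · simp only [zero_mul, Real.cos_zero, mul_one, zero_div, Real.sinc_zero, one_pow]
    rw [intervalIntegral.integral_sub intervalIntegrable_const
      (by exact (continuous_id.div_const R).intervalIntegrable 0 R),
      intervalIntegral.integral_const, intervalIntegral.integral_div, integral_id]
    field_simp
    ring
  · rw [intervalIntegral.integral_eq_sub_of_hasDerivAt (fun t _ => hasDerivAt_fejerPrim hκ hR.ne' t)
      (by
        apply Continuous.intervalIntegrable
        fun_prop)]
    have hs : Real.sinc (κ * R / 2) ^ 2 = 2 * (1 - Real.cos (κ * R)) / (κ * R) ^ 2 := by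
      rw [Real.sinc_of_ne_zero (by positivity), div_pow, Real.sin_sq_eq_half_sub,
        show 2 * (κ * R / 2) = κ * R by ring]
      field_simp
    rw [hs]
    simp only [mul_zero, Real.sin_zero, Real.cos_zero, div_self hR.ne', sub_self, zero_mul,
      zero_div, zero_sub]
    field_simp
    ring

/-- **The Fejér cosine integral**: `∫ (1 - |t|/R)₊ cos(κt) dt = R sinc²(κR/2)`. -/
theorem integral_tent₁_mul_cos (κ : ℝ) {R : ℝ} (hR : 0 < R) :
    ∫ t : ℝ, max (1 - |t| / R) 0 * Real.cos (κ * t) = R * Real.sinc (κ * R / 2) ^ 2 := by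
  set g : ℝ → ℝ := fun t => max (1 - |t| / R) 0 * Real.cos (κ * t) with hg
  have hgc : Continuous g := (continuous_tent₁ R).mul (by fun_prop)
  have heven : ∀ t, g (-t) = g t := fun t => by
    simp only [hg, abs_neg, mul_neg, Real.cos_neg]
  -- to an interval integral on `[-R, R]`
  rw [← intervalIntegral.integral_eq_integral_of_support_subset
    (support_tent₁_mul_subset hR fun t => Real.cos (κ * t))]
  change ∫ t in (-R)..R, g t = _
  rw [← intervalIntegral.integral_add_adjacent_intervals (b := 0)
    (hgc.intervalIntegrable _ _) (hgc.intervalIntegrable _ _)]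
  -- the left half equals the right half
  have hleft : ∫ t in (-R)..0, g t = ∫ t in (0 : ℝ)..R, g t := by
    have h := intervalIntegral.integral_comp_neg (a := 0) (b := R) (f := g)
    rw [neg_zero] at h
    rw [← h]
    exact intervalIntegral.integral_congr fun t _ => heven t
  rw [hleft, ← two_mul]
  -- on `[0, R]` the tent is `1 - t/R`
  have hright : ∫ t in (0 : ℝ)..R, g t = ∫ t in (0 : ℝ)..R, (1 - t / R) * Real.cos (κ * t) := by
    refine intervalIntegral.integral_congr fun t ht => ?_
    rw [uIcc_of_le hR.le, mem_Icc] at ht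
    simp only [hg]
    rw [abs_of_nonneg ht.1, max_eq_left]
    rw [sub_nonneg, div_le_one hR]
    exact ht.2
  rw [hright, integral_fejer_half κ hR]
  ring

/-- **The Fejér sine integral vanishes**: `∫ (1 - |t|/R)₊ sin(κt) dt = 0` (odd integrand). -/
theorem integral_tent₁_mul_sin (κ : ℝ) {R : ℝ} (hR : 0 < R) :
    ∫ t : ℝ, max (1 - |t| / R) 0 * Real.sin (κ * t) = 0 := by
  set g : ℝ → ℝ := fun t => max (1 - |t| / R) 0 * Real.sin (κ * t) with hg
  have hodd : ∀ t, g (-t) = -g t := fun t => by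
    simp only [hg, abs_neg, mul_neg, Real.sin_neg]
  rw [← intervalIntegral.integral_eq_integral_of_support_subset
    (support_tent₁_mul_subset hR fun t => Real.sin (κ * t))]
  change ∫ t in (-R)..R, g t = 0
  have h := intervalIntegral.integral_comp_neg (a := -R) (b := R) (f := g)
  rw [neg_neg] at h
  have h2 : ∫ t in (-R)..R, g (-t) = -∫ t in (-R)..R, g t := by
    rw [← intervalIntegral.integral_neg]
    exact intervalIntegral.integral_congr fun t _ => hodd t
  linarith

/-- **The Fejér integral, complex form**: `∫ (1 - |t|/R)₊ e^{iκt} dt = R sinc²(κR/2)`. -/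
theorem integral_tent₁_mul_cexp (κ : ℝ) {R : ℝ} (hR : 0 < R) :
    ∫ t : ℝ, ((max (1 - |t| / R) 0 : ℝ) : ℂ) * Complex.exp ((κ * t : ℝ) * Complex.I) =
      ((R * Real.sinc (κ * R / 2) ^ 2 : ℝ) : ℂ) := by
  have hsplit : ∀ t : ℝ, ((max (1 - |t| / R) 0 : ℝ) : ℂ) * Complex.exp ((κ * t : ℝ) * Complex.I) =
      ((max (1 - |t| / R) 0 * Real.cos (κ * t) : ℝ) : ℂ) +
        ((max (1 - |t| / R) 0 * Real.sin (κ * t) : ℝ) : ℂ) * Complex.I := by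
    intro t
    rw [Complex.exp_mul_I]
    push_cast
    ring
  simp_rw [hsplit]
  have hi1 : Integrable fun t : ℝ => ((max (1 - |t| / R) 0 * Real.cos (κ * t) : ℝ) : ℂ) :=
    (integrable_tent₁_mul hR (by fun_prop)).ofReal
  have hi2 : Integrable fun t : ℝ => ((max (1 - |t| / R) 0 * Real.sin (κ * t) : ℝ) : ℂ) * Complex.I :=
    (integrable_tent₁_mul hR (by fun_prop)).ofReal.mul_const _
  rw [integral_add hi1 hi2, MeasureTheory.integral_mul_const, integral_complex_ofReal, integral_complex_ofReal,
    integral_tent₁_mul_cos κ hR, integral_tent₁_mul_sin κ hR]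
  simp

/-! ### The three-dimensional tent -/

/-- The three-dimensional tent `∏ⱼ (1 - |yⱼ|/R)₊` is non-negative. -/
theorem tent_nonneg (R : ℝ) (y : Space) : 0 ≤ ∏ j, max (1 - |y j| / R) 0 :=
  Finset.prod_nonneg fun j _ => tent₁_nonneg R (y j)

/-- The three-dimensional tent is at most `1` (`R > 0`). -/
theorem tent_le_one {R : ℝ} (hR : 0 < R) (y : Space) : ∏ j, max (1 - |y j| / R) 0 ≤ 1 :=
  Finset.prod_le_one (fun j _ => tent₁_nonneg R (y j)) fun j _ => tent₁_le_one hR (y j)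

/-- The three-dimensional tent is continuous. -/
theorem continuous_tent (R : ℝ) : Continuous fun y : Space => ∏ j, max (1 - |y j| / R) 0 := by
  refine continuous_finsetProd _ fun j _ => ?_
  exact (continuous_tent₁ R).comp (PiLp.continuous_apply 2 (fun _ : Fin 3 => ℝ) j)

/-- Transfer of integrals on `ℝ³` to the product space `Fin 3 → ℝ`. -/
theorem integral_euclidean_eq_integral_pi {F : Type*} [NormedAddCommGroup F] [NormedSpace ℝ F]
    (g : (Fin 3 → ℝ) → F) : ∫ y : Space, g (fun j => y j) = ∫ x : Fin 3 → ℝ, g x :=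
  (EuclideanSpace.volume_preserving_symm_measurableEquiv_toLp (Fin 3)).integral_comp' g

/-- Transfer of integrability on `ℝ³` from the product space `Fin 3 → ℝ`. -/
theorem integrable_euclidean_of_integrable_pi {F : Type*} [NormedAddCommGroup F]
    {g : (Fin 3 → ℝ) → F} (hg : Integrable g) : Integrable fun y : Space => g (fun j => y j) :=
  (EuclideanSpace.volume_preserving_symm_measurableEquiv_toLp (Fin 3)).integrable_comp_emb
    (MeasurableEquiv.measurableEmbedding _) |>.2 hg

/-- **The tent is integrable** on `ℝ³`. -/
theorem integrable_tent {R : ℝ} (hR : 0 < R) :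
    Integrable fun y : Space => ∏ j, max (1 - |y j| / R) 0 := by
  have h1 : ∀ _j : Fin 3, Integrable fun t : ℝ => max (1 - |t| / R) 0 := fun _ => by
    simpa using integrable_tent₁_mul hR continuous_const (g := fun _ => (1 : ℝ))
  have h := Integrable.fintype_prod (ι := Fin 3) (f := fun _ t => max (1 - |t| / R) 0)
    (μ := fun _ => volume) h1
  rw [← volume_pi] at h
  exact integrable_euclidean_of_integrable_pi h

/-- **Mass of the tent**: `∫_{ℝ³} ∏ⱼ (1 - |yⱼ|/R)₊ dy = R³`. -/
theorem integral_tent {R : ℝ} (hR : 0 < R) :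
    ∫ y : Space, ∏ j, max (1 - |y j| / R) 0 = R ^ 3 := by
  rw [integral_euclidean_eq_integral_pi (fun x : Fin 3 → ℝ => ∏ j, max (1 - |x j| / R) 0),
    integral_fintype_prod_volume_eq_prod (ι := Fin 3) (fun _ t => max (1 - |t| / R) 0)]
  have h1 : ∫ t : ℝ, max (1 - |t| / R) 0 = R := by
    have h := integral_tent₁_mul_cos 0 hR
    simpa using h
  simp [h1]

/-- A bounded a.e.-strongly measurable function times the tent is integrable on `ℝ³`. -/
theorem integrable_tent_mul {R : ℝ} (hR : 0 < R) {g : Space → ℝ}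
    (hg : AEStronglyMeasurable g volume) {C : ℝ} (hC : ∀ y, ‖g y‖ ≤ C) :
    Integrable fun y : Space => (∏ j, max (1 - |y j| / R) 0) * g y :=
  (integrable_tent hR).mul_bdd hg (Filter.Eventually.of_forall hC)

/-- **The Fejér kernel identity on `ℝ³`.** For `k ∈ ℝ³` and `R > 0`,
`∫ ∏ⱼ (1 - |yⱼ|/R)₊ cos(∑ⱼ kⱼyⱼ) dy = R³ ∏ⱼ sinc²(kⱼR/2)`: the Fourier multiplier of the
translate-averaged cube window of side `R` is the Fejér weight. -/
theorem integral_tent_mul_cos (k : Space) {R : ℝ} (hR : 0 < R) :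
    ∫ y : Space, (∏ j, max (1 - |y j| / R) 0) * Real.cos (∑ j, k j * y j) =
      R ^ 3 * ∏ j, Real.sinc (k j * R / 2) ^ 2 := by
  -- the complex factors
  set F : Fin 3 → ℝ → ℂ := fun j t => ((max (1 - |t| / R) 0 : ℝ) : ℂ) * Complex.exp ((k j * t : ℝ) * Complex.I)
    with hF
  have hFi : ∀ j, Integrable (F j) := fun j => by
    have h1 : Integrable fun t : ℝ => ((max (1 - |t| / R) 0 : ℝ) : ℂ) :=
      (by simpa using integrable_tent₁_mul hR continuous_const (g := fun _ => (1 : ℝ)) :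
        Integrable fun t : ℝ => max (1 - |t| / R) 0).ofReal
    refine h1.mul_bdd (c := 1) (by fun_prop) (Filter.Eventually.of_forall fun t => ?_)
    rw [Complex.norm_exp_ofReal_mul_I]
  -- pointwise: the real integrand is the real part of the product
  have hpt : ∀ y : Space, (∏ j, max (1 - |y j| / R) 0) * Real.cos (∑ j, k j * y j) =
      (∏ j, F j (y j)).re := by
    intro y
    simp only [hF]
    rw [Finset.prod_mul_distrib, ← Complex.exp_sum, ← Complex.ofReal_prod]
    have : (∑ j, ((k j * y j : ℝ) : ℂ) * Complex.I) = ((∑ j, k j * y j : ℝ) : ℂ) * Complex.I := by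
      push_cast; rw [Finset.sum_mul]
    rw [this, Complex.re_ofReal_mul, Complex.exp_ofReal_mul_I_re]
  simp_rw [hpt]
  -- integrability of the complex product on `ℝ³`
  have hprod : Integrable fun y : Space => ∏ j, F j (y j) := by
    have h := Integrable.fintype_prod (ι := Fin 3) (f := F) (μ := fun _ => volume) hFi
    rw [← volume_pi] at h
    exact integrable_euclidean_of_integrable_pi h
  have hre := integral_re hprod
  simp only [RCLike.re_to_complex] at hre
  rw [hre]
  rw [integral_euclidean_eq_integral_pi (fun x : Fin 3 → ℝ => ∏ j, F j (x j)),
    integral_fintype_prod_volume_eq_prod (ι := Fin 3) F]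
  simp only [hF, integral_tent₁_mul_cexp _ hR]
  rw [← Complex.ofReal_prod, Complex.ofReal_re, Finset.prod_mul_distrib]
  simp [Finset.prod_const]

end Summit.AtomisticToContinuum.BoseEinsteinCondensation.Theorems.CoreDeficitBounds

end
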